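import Mathlib
import Summits.ValiantsHypothesis.ValiantsHypothesis.Theses.FeketeSOS
import Summits.ValiantsHypothesis.ValiantsHypothesis.Theorems.FeketeSOSSublinearShadowTrivialShadow
import Summits.ValiantsHypothesis.ValiantsHypothesis.Theorems.FeketeSOSSublinearShadowThreeSquares
import Summits.ValiantsHypothesis.ValiantsHypothesis.Theorems.FeketeSOSSublinearShadowGramShadow

/-!
# `FeketeSOS.SublinearShadow` (stmt-ValiantsHypothesis-14990), line `Sketch`, reshape 5 — THE EVERYWHERE-GRAM-DEEP CORE

`sublinearShadow_iff_coreFewGramDeep`: the crux `SublinearShadow` is EQUIVALENT to its restriction to complex representations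
`Σ_{i<s} c_i g_i² = F_p` (`deg g_i ≤ p²`, support-sum `S`, `S⁴ ≤ p³`) with `3 ≤ s` squares, FEW squares (`(s+1)^A · S < 2p`),
PARETO-MINIMAL support-sum among representations with `≤ s` squares, AND whose GRAM MATRIX `Q_{ab} = Σ_i c_i g_{i,a} g_{i,b}`
has a non-`O`-integral entry at EVERY valuation subring `O ⊂ ℂ` with `p ∈ 𝔪_O` — with the crux's own conclusion block.

Compared with `sublinearShadow_iff_coreFew` (reshape 3, p106582) and `sublinearShadow_iff_coreFewDeep` (reshape 4, p138283: at
least three non-integral TERMS at every place) the new normalising hypothesis is Gram-depth at every place.  It is bought by the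
GRAM TRANSFER `stub_gramShadow` (`Theorems/FeketeSOSSublinearShadowGramShadow.lean`): a place over `p` at which the Gram matrix is
integral yields a cyclic characteristic-`p` shadow with `≤ 2s²` squares and support `≤ 2s²·S` (maximal-minor factorisation of the
coefficient matrix over `O`, the representation as an `O`-integral quadratic form `Σ Q_{a_j a_{j'}} h_j h_{j'}` in `O`-integral
`δ`-normalised polynomials `h_j`, reduction, polarisation into `2r²` squares, cyclic folding).  The Gram matrix is invariant under
every re-factorisation of the representation through the same span, and it is `p`-integral for the disprover's deep examples
(`fekete_five_deep_minimal`, the triagers' `G_p`; TRIAGE-r1-3 (N1)), which are therefore OUTSIDE the residual class.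

`→` is restriction.  `←` (constants `A ↦ A + 3`, `p₁ ↦ max p₁ 257`): Pareto-minimal representative by `Nat.find`, `≥ 3` squares
(`stub_threeSquares`), the universal two-square shadow over `ZMod p` (`stub_trivialShadow`) when `2p ≤ (s₀+1)^A · S₀`; otherwise
either some place has an integral Gram matrix (`stub_gramShadow`, `d ≤ 2s₀² ≤ (s+1)³`, support `≤ 2s₀²·S₀`) or the core applies to
the minimal representation; monotonicity of both budgets.
-/

namespace Summit.ValiantsHypothesis.ValiantsHypothesis.Theorems.SublinearShadowSketch

open Polynomial Finset IsLocalRing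
open scoped BigOperators

-- `Summit.ValiantsHypothesis.ValiantsHypothesis.…` is the tree's mandated single-conjunct layout (Sub = Summit).
set_option linter.dupNamespace false

/-- `(s+1)^3 ≥ 2 s²`. -/
theorem gcr_two_mul_sq_le_cube (s : ℕ) : 2 * (s * s) ≤ (s + 1) ^ 3 := by
  have : (s + 1) ^ 3 = s * s * s + 3 * (s * s) + 3 * s + 1 := by ring
  rw [this]; nlinarith [Nat.zero_le s]

/-- **The crux ⟺ its everywhere-Gram-deep few-squares Pareto-minimal core.**  `FeketeSOS.SublinearShadow` holds iff, for some
`A, p₁` and all primes `p ≥ p₁`, every complex representation `Σ_{i<s} c_i g_i² = F_p` with `deg g_i ≤ p²`, `S⁴ ≤ p³`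
(`S = Σ|supp g_i|`), `3 ≤ s`, `(s+1)^A · S < 2p`, Pareto-minimal support-sum among representations with `≤ s` squares, and
Gram matrix `(Σ_i c_i g_{i,a} g_{i,b})_{a,b}` with a non-`O`-integral entry at every valuation subring `O ⊂ ℂ` with `p ∈ 𝔪_O`,
has a cyclic characteristic-`p` shadow with `≤ (s+1)^A` squares of degree `< p` and support `≤ (s+1)^A · S`. -/
theorem sublinearShadow_iff_coreFewGramDeep :
    Summit.ValiantsHypothesis.ValiantsHypothesis.Theses.FeketeSOS.SublinearShadow ↔
    ∃ A p₁ : ℕ, ∀ (p : ℕ) [Fact p.Prime], p₁ ≤ p → ∀ (s : ℕ) (c : Fin s → ℂ) (g : Fin s → Polynomial ℂ),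
      (∀ i, (g i).natDegree ≤ p ^ 2) → (∑ i, (g i).support.card) ^ 4 ≤ p ^ 3 →
      (∑ i, Polynomial.C (c i) * g i ^ 2)
        = ∑ m ∈ Finset.range p, Polynomial.C ((legendreSym p m : ℤ) : ℂ) * Polynomial.X ^ m →
      3 ≤ s → (s + 1) ^ A * (∑ i, (g i).support.card) < 2 * p →
      (∀ (s' : ℕ) (c' : Fin s' → ℂ) (g' : Fin s' → Polynomial ℂ), s' ≤ s →
        (∀ i, (g' i).natDegree ≤ p ^ 2) →
        (∑ i, Polynomial.C (c' i) * g' i ^ 2)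
          = ∑ m ∈ Finset.range p, Polynomial.C ((legendreSym p m : ℤ) : ℂ) * Polynomial.X ^ m →
        (∑ i, (g i).support.card) ≤ ∑ i, (g' i).support.card) →
      (∀ O : ValuationSubring ℂ, ((p : ℕ) : O) ∈ maximalIdeal O →
        ∃ a b : ℕ, (∑ i, c i * (g i).coeff a * (g i).coeff b) ∉ O) →
      ∃ (K : Type) (_ : Field K) (_ : CharP K p) (d : ℕ) (c' : Fin d → K) (g' : Fin d → Polynomial K),
        d ≤ (s + 1) ^ A ∧ (∀ j, (g' j).natDegree < p) ∧
        (∑ j, (g' j).support.card) ≤ (s + 1) ^ A * ∑ i, (g i).support.card ∧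
        ((Polynomial.X : Polynomial K) ^ p - 1 ∣ (∑ j, Polynomial.C (c' j) * g' j ^ 2)
          - ∑ m ∈ Finset.range p, Polynomial.C ((legendreSym p m : ℤ) : K) * Polynomial.X ^ m) := by
  constructor
  · -- restriction: drop the four normalising hypotheses
    rintro ⟨A, p₁, H⟩
    exact ⟨A, p₁, fun p _ hp s c g hdeg hS hrep _ _ _ _ => H p hp s c g hdeg hS hrep⟩
  · rintro ⟨A, p₁, H⟩
    unfold Summit.ValiantsHypothesis.ValiantsHypothesis.Theses.FeketeSOS.SublinearShadow
    refine ⟨A + 3, max p₁ 257, ?_⟩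
    intro p _ hp s c g hdeg hS hrep
    classical
    have hprime : p.Prime := Fact.out
    have hp₁ : p₁ ≤ p := le_trans (le_max_left _ _) hp
    have hp257 : 257 ≤ p := le_trans (le_max_right _ _) hp
    have hp2 : p ≠ 2 := by omega
    -- Step 0: a Pareto-minimal representation below `(s, c, g)`
    set Srep : ℕ := ∑ i, (g i).support.card with hSrep
    have hex : ∃ n, ∃ (s' : ℕ) (c' : Fin s' → ℂ) (g' : Fin s' → Polynomial ℂ), s' ≤ s ∧
        (∀ i, (g' i).natDegree ≤ p ^ 2) ∧
        (∑ i, Polynomial.C (c' i) * g' i ^ 2)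
          = ∑ m ∈ Finset.range p, Polynomial.C ((legendreSym p m : ℤ) : ℂ) * Polynomial.X ^ m ∧
        (∑ i, (g' i).support.card) = n := ⟨Srep, s, c, g, le_rfl, hdeg, hrep, rfl⟩
    obtain ⟨s₀, c₀, g₀, hs₀, hdeg₀, hrep₀, hS₀⟩ := Nat.find_spec hex
    have hmin₀ : ∀ (s' : ℕ) (c' : Fin s' → ℂ) (g' : Fin s' → Polynomial ℂ), s' ≤ s →
        (∀ i, (g' i).natDegree ≤ p ^ 2) →
        (∑ i, Polynomial.C (c' i) * g' i ^ 2)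
          = ∑ m ∈ Finset.range p, Polynomial.C ((legendreSym p m : ℤ) : ℂ) * Polynomial.X ^ m →
        Nat.find hex ≤ ∑ i, (g' i).support.card :=
      fun s' c' g' hs' hdeg' hrep' => Nat.find_min' hex ⟨s', c', g', hs', hdeg', hrep', rfl⟩
    set S₀ : ℕ := ∑ i, (g₀ i).support.card with hS₀def
    have hS₀le : S₀ ≤ Srep := by rw [hS₀]; exact hmin₀ s c g le_rfl hdeg hrep
    have hS₀4 : S₀ ^ 4 ≤ p ^ 3 := le_trans (Nat.pow_le_pow_left hS₀le 4) hS
    have hmin : ∀ (s' : ℕ) (c' : Fin s' → ℂ) (g' : Fin s' → Polynomial ℂ), s' ≤ s₀ →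
        (∀ i, (g' i).natDegree ≤ p ^ 2) →
        (∑ i, Polynomial.C (c' i) * g' i ^ 2)
          = ∑ m ∈ Finset.range p, Polynomial.C ((legendreSym p m : ℤ) : ℂ) * Polynomial.X ^ m →
        S₀ ≤ ∑ i, (g' i).support.card := fun s' c' g' hs' hdeg' hrep' => by
      rw [hS₀]; exact hmin₀ s' c' g' (hs'.trans hs₀) hdeg' hrep'
    -- Step 1: at least three squares; budget arithmetic
    have h3 : 3 ≤ s₀ := stub_threeSquares p hp257 s₀ c₀ g₀ hS₀4 hrep₀
    have hs1 : (s₀ + 1) ^ A ≤ (s + 1) ^ A := Nat.pow_le_pow_left (Nat.succ_le_succ hs₀) A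
    have hsA : (s + 1) ^ A ≤ (s + 1) ^ (A + 3) := Nat.pow_le_pow_right (Nat.succ_pos s) (Nat.le_add_right A 3)
    have hcube : (s + 1) ^ 3 ≤ (s + 1) ^ (A + 3) := Nat.pow_le_pow_right (Nat.succ_pos s) (Nat.le_add_left 3 A)
    have hsq : 2 * (s₀ * s₀) ≤ (s + 1) ^ (A + 3) :=
      le_trans (le_trans (gcr_two_mul_sq_le_cube s₀) (Nat.pow_le_pow_left (Nat.succ_le_succ hs₀) 3)) hcube
    by_cases hmany : 2 * p ≤ (s₀ + 1) ^ A * S₀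
    · -- Step 2a: many squares — the trivial two-square shadow over `ZMod p`
      obtain ⟨c', g', hdeg', hcard', hrep'⟩ := stub_trivialShadow p hp2
      refine ⟨ZMod p, inferInstance, inferInstance, 2, c', g', ?_, hdeg', ?_, ?_⟩
      · calc 2 ≤ 2 * (s₀ * s₀) := by nlinarith
          _ ≤ (s + 1) ^ (A + 3) := hsq
      · calc ∑ j, (g' j).support.card ≤ 2 * p := hcard'
          _ ≤ (s₀ + 1) ^ A * S₀ := hmany
          _ ≤ (s + 1) ^ (A + 3) * Srep := Nat.mul_le_mul (hs1.trans hsA) hS₀le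
      · rw [hrep', sub_self]; exact dvd_zero _
    · push Not at hmany
      by_cases hdeep : ∀ O : ValuationSubring ℂ, ((p : ℕ) : O) ∈ maximalIdeal O →
          ∃ a b : ℕ, (∑ i, c₀ i * (g₀ i).coeff a * (g₀ i).coeff b) ∉ O
      · -- Step 2b: everywhere Gram-deep — the core, applied to the minimal representation
        obtain ⟨K, instF, instC, d, c', g', hd, hdeg', hcard, hdvd⟩ :=
          H p hp₁ s₀ c₀ g₀ hdeg₀ hS₀4 hrep₀ h3 hmany hmin hdeep
        refine ⟨K, instF, instC, d, c', g', ?_, hdeg', ?_, hdvd⟩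
        · exact hd.trans (hs1.trans hsA)
        · calc ∑ j, (g' j).support.card ≤ (s₀ + 1) ^ A * S₀ := hcard
            _ ≤ (s + 1) ^ (A + 3) * Srep := Nat.mul_le_mul (hs1.trans hsA) hS₀le
      · -- Step 2c: some place over `p` with an integral Gram matrix — the Gram transfer
        push Not at hdeep
        obtain ⟨O, hpO, hgram⟩ := hdeep
        obtain ⟨K, instF, instC, d, c', g', hd, hdeg', hcard, hdvd⟩ :=
          stub_gramShadow p hp2 s₀ c₀ g₀ hrep₀ O hpO hgram
        refine ⟨K, instF, instC, d, c', g', hd.trans hsq, hdeg', ?_, hdvd⟩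
        calc ∑ j, (g' j).support.card ≤ 2 * (s₀ * s₀) * S₀ := hcard
          _ ≤ (s + 1) ^ (A + 3) * Srep := Nat.mul_le_mul hsq hS₀le

end Summit.ValiantsHypothesis.ValiantsHypothesis.Theorems.SublinearShadowSketch
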